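import Summits.CriticalPhenomena.PercolationContinuityZ3.Theorems.PercNearOneGluingNoHeavyLowerTailMajorityGluingQCertSevenFive2
import HarnessLib

/-!
# The `(7,5)` certificate with constant `61/50` PASSES: quadratic check on the rows `[96, 129)` and assembly (lane prim-rate, constants-miner 1, gen 34; CANDIDATES §GEN-34 R327)

Support file for the closed crux `NoHeavyLowerTail` (stmt-CriticalPhenomena-4575), majority-gluing line; continuation of `…QCertSevenFive/2`: the last two chunks and
**`sevenFive_check : sevenFive.check = true`** (`checkQ_append` over the six chunks).  The percolation reading («μ(≥ 5 of 7 relays cut) ≤ (61/50)·max marginal»,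
`C(9) ≤ 111/50`) is `…MajorityGluingNineCert`.  No sorries.
-/

namespace Summit.CriticalPhenomena.PercolationContinuityZ3.Theorems

namespace HubOnly
namespace QCert

set_option maxHeartbeats 0 in
/-- The quadratic check passes on the variable rows `[96, 112)`. -/
theorem sevenFive_checkQ_96 : sevenFive.checkQ 96 112 = true := by decide +kernel

set_option maxHeartbeats 0 in
/-- The quadratic check passes on the variable rows `[112, 129)`. -/
theorem sevenFive_checkQ_112 : sevenFive.checkQ 112 129 = true := by decide +kernel

/-- The quadratic check passes on all `129` variable rows. -/
theorem sevenFive_checkQ : sevenFive.checkQ 0 sevenFive.NV = true :=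
  sevenFive.checkQ_append (sevenFive.checkQ_append (sevenFive.checkQ_append (sevenFive.checkQ_append (sevenFive.checkQ_append
    sevenFive_checkQ_0 sevenFive_checkQ_24) sevenFive_checkQ_48) sevenFive_checkQ_72) sevenFive_checkQ_96) sevenFive_checkQ_112

/-- **THE `(7,5)` `61/50` CERTIFICATE PASSES.** -/
theorem sevenFive_check : sevenFive.check = true := by
  rw [Cert.check, sevenFive_checkW, sevenFive_checkQ, Bool.true_and]

end QCert
end HubOnly

end Summit.CriticalPhenomena.PercolationContinuityZ3.Theorems
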